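import Mathlib
import Summits.ValiantsHypothesis.ValiantsHypothesis.Theorems.GrenetZeonTwoDimCoefficientsScalingPermPointHessian

/-!
# Crux `GrenetZeon.TwoDimCoefficients` (stmt-ValiantsHypothesis-8062) / rung `DualUnipotentThreeHalves` (stmt-24318):
# scaling-closure — PER-GENERICITY AT UNITRIANGULAR POINTS (an `n(n−1)/2`-parameter full-rank family through every permutation point)

Fourth explicit family of FULL-RANK points of the Hessian of the permanent, and the largest: for ANY row order `ρ`, ANY column
order `κ` and ARBITRARY entries `w` above the resulting diagonal, the «unitriangular» point

  `z_{r,c} = 1 if ρ r = κ c`, `= w_{r,c} if ρ r < κ c`, `= 0 if ρ r > κ c`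

has `rank Hess per_n (z) = n²` (`n ≥ 2`).  Proof: with the weight `β(a,b) = κ b − ρ a` the Hessian entry `((c,d),(a,b))`
(an `(n−2)`-sub-permanent, tree `hess0_transl_perPoly`) VANISHES when `β(a,b) + β(c,d) > 0` and EQUALS the entry at the
permutation point `w = 0` when `β(a,b) + β(c,d) = 0` (a permutation `π` with all `ρ(π i) ≤ κ i` off `{b,d}` has
`Σ_{i∉{b,d}} (κ i − ρ π i) = −(β(a,b)+β(c,d))` by `Σ ρ∘π = Σ κ`); after the column involution `(a,b) ↦ (τ₀ b, τ₀⁻¹ a)`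
(`τ₀ = ρ⁻¹κ`, which negates `β`) the Hessian is BLOCK-TRIANGULAR for `β` with the same diagonal blocks as at the permutation point,
so its determinant is that of ✓ `rank_hess0_transl_permPoint_perPoly` (p836772), non-zero.

* ★ `hess0_transl_unitri_perPoly_apply_eq_zero` / `hess0_transl_unitri_perPoly_apply_eq_perm` — the two weight rules;
* ★★ `rank_hess0_transl_unitri_perPoly` — `rank Hess per_n (z) = n²` for every unitriangular point.

Use (memo NINETEENTH-HAND.md §3, per-genericity PG(k)): a subspace `V ≤ M_n(ℂ)` of codimension `k ≤ n/2` meets some affine family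
`P_{τ₀} + 𝔲_{ρ,κ}` (put the `≤ k` pivot rows of `V^⊥` first in `ρ` and the `≤ k` pivot columns last in `κ`), hence contains a
full-rank point — the assembly is left to the next hand; this file is the point-family half.

HONEST FRAMING: an unconditional, route-independent computation about the permanent (no Theses import); it closes no stub:
`DualUnipotentBound`, crux 8062, the 24318 decl and `VP ≠ VNP` remain open.

References: T. Mignon, N. Ressayre, Int. Math. Res. Not. 2004:79, §3 (via the tree); folklore.
-/

-- single-conjunct layout `Summits/ValiantsHypothesis/ValiantsHypothesis`: the duplicated namespace
-- component is mandated by the tree.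
set_option linter.dupNamespace false
set_option autoImplicit false

noncomputable section

namespace Summit.ValiantsHypothesis.ValiantsHypothesis.Theorems.GrenetZeonTwoDimCoefficients.ScalingClosure

open MvPolynomial Matrix
open Literature.Computability.AlgebraicComplexity

section UnitriangularPoint

variable {n : ℕ}

/-- The weight bookkeeping of a permutation `π` with `π b = a`, `π d = c` (`b ≠ d`) all of whose values off `{b, d}` satisfy
`ρ (π i) ≤ κ i`: then `κ b + κ d ≤ ρ a + ρ c`, with equality forcing `ρ (π i) = κ i` off `{b, d}`. [folklore] -/
theorem perm_weight_le (ρ κ π : Equiv.Perm (Fin n)) {a b c d : Fin n} (hb : π b = a) (hd : π d = c) (hdb : d ≠ b)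
    (hle : ∀ i ∈ (Finset.univ.erase b).erase d, ((ρ (π i)).val : ℕ) ≤ (κ i).val) :
    (κ b).val + (κ d).val ≤ (ρ a).val + (ρ c).val ∧
      ((κ b).val + (κ d).val = (ρ a).val + (ρ c).val → ∀ i ∈ (Finset.univ.erase b).erase d, ρ (π i) = κ i) := by
  classical
  -- `Σ_i ρ (π i) = Σ_i κ i`
  have hρπ : ∑ i : Fin n, (ρ (π i)).val = ∑ j : Fin n, j.val := by
    have h := Equiv.sum_comp (π.trans ρ) (fun j : Fin n => j.val)
    simpa only [Equiv.trans_apply] using h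
  have hκs : ∑ i : Fin n, (κ i).val = ∑ j : Fin n, j.val := by
    have h := Equiv.sum_comp κ (fun j : Fin n => j.val)
    simpa only using h
  have htot : ∑ i : Fin n, (ρ (π i)).val = ∑ i : Fin n, (κ i).val := hρπ.trans hκs.symm
  -- split off `b` and `d`
  have hsplit : ∀ f : Fin n → ℕ, ∑ i, f i = (∑ i ∈ (Finset.univ.erase b).erase d, f i) + f d + f b := by
    intro f
    rw [← Finset.sum_erase_add _ _ (Finset.mem_univ b),
      ← Finset.sum_erase_add _ _ (Finset.mem_erase.mpr ⟨hdb, Finset.mem_univ d⟩)]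
  have h1 := hsplit (fun i => (ρ (π i)).val)
  have h2 := hsplit (fun i => (κ i).val)
  simp only [hb, hd] at h1
  have hT : ∑ i ∈ (Finset.univ.erase b).erase d, (ρ (π i)).val ≤ ∑ i ∈ (Finset.univ.erase b).erase d, (κ i).val :=
    Finset.sum_le_sum hle
  refine ⟨by omega, fun heq => ?_⟩
  have hTeq : ∑ i ∈ (Finset.univ.erase b).erase d, (ρ (π i)).val = ∑ i ∈ (Finset.univ.erase b).erase d, (κ i).val := by
    omega
  have hall := (Finset.sum_eq_sum_iff_of_le hle).mp hTeq
  intro i hi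
  exact Fin.ext (hall i hi)

/-- ★ **Weight rule I** — at a unitriangular point (`ρ`-row / `κ`-column orders, arbitrary entries `w` above the diagonal) the
Hessian entry `((c,d),(a,b))` of `per_n` VANISHES when `κ b + κ d > ρ a + ρ c`. [cite: MignonRessayre2004, §3 — via the tree;
folklore] -/
theorem hess0_transl_unitri_perPoly_apply_eq_zero (ρ κ : Equiv.Perm (Fin n)) (w z : Fin n × Fin n → ℂ)
    (hz : ∀ u, z u = if ρ u.1 = κ u.2 then 1 else if (ρ u.1).val < (κ u.2).val then w u else 0)
    {a b c d : Fin n} (hgt : (ρ a).val + (ρ c).val < (κ b).val + (κ d).val) :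
    hess0 (transl z (perPoly (Fin n) ℂ)) (c, d) (a, b) = 0 := by
  classical
  rw [hess0_transl_perPoly]
  refine Finset.sum_eq_zero fun π _ => ?_
  by_cases hP : π b = a ∧ d ≠ b ∧ π d = c
  · rw [if_pos hP]
    by_contra hne
    have hne' := Finset.prod_ne_zero_iff.mp hne
    have hle : ∀ i ∈ (Finset.univ.erase b).erase d, ((ρ (π i)).val : ℕ) ≤ (κ i).val := by
      intro i hi
      have h := hne' i hi
      rw [hz] at h
      dsimp only at h
      by_contra hlt
      rw [if_neg, if_neg (fun h' => hlt h'.le)] at h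
      · exact h rfl
      · intro h'
        exact hlt (le_of_eq (congrArg Fin.val h'))
    have := (perm_weight_le ρ κ π hP.1 hP.2.2 hP.2.1 hle).1
    omega
  · rw [if_neg hP]

/-- ★ **Weight rule II** — when `κ b + κ d = ρ a + ρ c` the Hessian entry `((c,d),(a,b))` of `per_n` at the unitriangular point equals
the entry at the underlying permutation point `P_{τ₀}`, `τ₀ = ρ⁻¹ κ` (only permutations agreeing with `τ₀` off `{b, d}` survive,
and their products are `1`). [cite: MignonRessayre2004, §3 — via the tree; folklore] -/
theorem hess0_transl_unitri_perPoly_apply_eq_perm (ρ κ : Equiv.Perm (Fin n)) (w z : Fin n × Fin n → ℂ)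
    (hz : ∀ u, z u = if ρ u.1 = κ u.2 then 1 else if (ρ u.1).val < (κ u.2).val then w u else 0)
    {a b c d : Fin n} (heq : (ρ a).val + (ρ c).val = (κ b).val + (κ d).val) :
    hess0 (transl z (perPoly (Fin n) ℂ)) (c, d) (a, b) =
      hess0 (transl (fun u : Fin n × Fin n => if u.1 = (ρ⁻¹ * κ) u.2 then (1 : ℂ) else 0) (perPoly (Fin n) ℂ))
        (c, d) (a, b) := by
  classical
  have hτ₀ : ∀ r s : Fin n, (r = (ρ⁻¹ * κ) s ↔ ρ r = κ s) := by
    intro r s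
    rw [Equiv.Perm.mul_apply, Equiv.Perm.eq_inv_iff_eq]
  rw [hess0_transl_perPoly, hess0_transl_perPoly]
  refine Finset.sum_congr rfl fun π _ => ?_
  by_cases hP : π b = a ∧ d ≠ b ∧ π d = c
  · rw [if_pos hP, if_pos hP]
    set T := (Finset.univ.erase b).erase d with hT
    by_cases hagree : ∀ i ∈ T, ρ (π i) = κ i
    · -- both products are `1`
      rw [Finset.prod_eq_one, Finset.prod_eq_one]
      · intro i hi
        dsimp only
        rw [if_pos ((hτ₀ _ _).mpr (hagree i hi))]
      · intro i hi
        rw [hz]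
        dsimp only
        rw [if_pos (hagree i hi)]
    · -- both products vanish
      push Not at hagree
      obtain ⟨i₀, hi₀, hne₀⟩ := hagree
      have hPz : (∏ i ∈ T, (fun u : Fin n × Fin n => if u.1 = (ρ⁻¹ * κ) u.2 then (1 : ℂ) else 0) (π i, i)) = 0 := by
        refine Finset.prod_eq_zero hi₀ ?_
        dsimp only
        rw [if_neg (fun h => hne₀ ((hτ₀ _ _).mp h))]
      rw [hPz]
      by_contra hne
      have hne' := Finset.prod_ne_zero_iff.mp hne
      have hle : ∀ i ∈ T, ((ρ (π i)).val : ℕ) ≤ (κ i).val := by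
        intro i hi
        have h := hne' i hi
        rw [hz] at h
        dsimp only at h
        by_contra hlt
        rw [if_neg, if_neg (fun h' => hlt h'.le)] at h
        · exact h rfl
        · intro h'
          exact hlt (le_of_eq (congrArg Fin.val h'))
      have hall := (perm_weight_le ρ κ π hP.1 hP.2.2 hP.2.1 hle).2 heq.symm
      exact hne₀ (hall i₀ hi₀)
  · rw [if_neg hP, if_neg hP]

/-- ★★ **Every unitriangular point is a full-rank point of the Hessian of the permanent**: for `n ≥ 2`, any row order `ρ`,
column order `κ` and any entries `w` above the diagonal `{ρ r = κ c}`, `rank Hess per_n (z) = n²`.  (Block-triangularity in the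
weight `κ d − ρ c` after the column involution `(a,b) ↦ (τ₀ b, τ₀⁻¹ a)`, diagonal blocks those of the permutation point `P_{τ₀}`,
✓ `rank_hess0_transl_permPoint_perPoly`.) [cite: MignonRessayre2004, §3 — via the tree; folklore] -/
theorem rank_hess0_transl_unitri_perPoly (hn : 2 ≤ n) (ρ κ : Equiv.Perm (Fin n)) (w : Fin n × Fin n → ℂ) :
    (hess0 (transl (fun u : Fin n × Fin n =>
        if ρ u.1 = κ u.2 then (1 : ℂ) else if (ρ u.1).val < (κ u.2).val then w u else 0) (perPoly (Fin n) ℂ))).rank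
      = n ^ 2 := by
  classical
  set z : Fin n × Fin n → ℂ := fun u =>
    if ρ u.1 = κ u.2 then (1 : ℂ) else if (ρ u.1).val < (κ u.2).val then w u else 0 with hzdef
  have hz : ∀ u, z u = if ρ u.1 = κ u.2 then 1 else if (ρ u.1).val < (κ u.2).val then w u else 0 := fun u => rfl
  -- `τ₀ = ρ⁻¹ κ` and the column involution `ι (a, b) = (τ₀ b, τ₀⁻¹ a)` negating the weight
  have hρτ : ∀ b, ρ ((ρ⁻¹ * κ) b) = κ b := fun b => ρ.apply_symm_apply (κ b)
  have hκτ : ∀ a, κ ((ρ⁻¹ * κ)⁻¹ a) = ρ a := fun a => κ.apply_symm_apply (ρ a)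
  set ι : Equiv.Perm (Fin n × Fin n) :=
    ⟨fun u => ((ρ⁻¹ * κ) u.2, (ρ⁻¹ * κ)⁻¹ u.1), fun u => ((ρ⁻¹ * κ) u.2, (ρ⁻¹ * κ)⁻¹ u.1),
      fun u => by simp, fun u => by simp⟩ with hιdef
  have hι : ∀ a b : Fin n, ι (a, b) = ((ρ⁻¹ * κ) b, (ρ⁻¹ * κ)⁻¹ a) := fun a b => rfl
  -- weight, shifted into `ℕ`: `β(c,d) = κ d + (n − ρ c)`
  set β : Fin n × Fin n → ℕ := fun u => (κ u.2).val + (n - (ρ u.1).val) with hβdef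
  have hβ : ∀ c d : Fin n, β (c, d) = (κ d).val + (n - (ρ c).val) := fun c d => rfl
  -- the permutation point `P_{τ₀}` is the unitriangular point with `w = 0`
  have hz0 : ∀ u : Fin n × Fin n, (fun u : Fin n × Fin n => if u.1 = (ρ⁻¹ * κ) u.2 then (1 : ℂ) else 0) u =
      if ρ u.1 = κ u.2 then 1 else if (ρ u.1).val < (κ u.2).val then (fun _ => (0 : ℂ)) u else 0 := by
    intro u
    dsimp only
    have h : (u.1 = (ρ⁻¹ * κ) u.2 ↔ ρ u.1 = κ u.2) := by
      rw [Equiv.Perm.mul_apply, Equiv.Perm.eq_inv_iff_eq]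
    by_cases hu : ρ u.1 = κ u.2
    · rw [if_pos (h.mpr hu), if_pos hu]
    · rw [if_neg (fun h' => hu (h.mp h')), if_neg hu, ite_self]
  -- block triangularity of both column-permuted Hessians
  have hGT : ((hess0 (transl z (perPoly (Fin n) ℂ))).submatrix id ι).BlockTriangular β := by
    rintro ⟨c, d⟩ ⟨a, b⟩ hlt
    rw [hβ, hβ] at hlt
    rw [Matrix.submatrix_apply, id, hι]
    refine hess0_transl_unitri_perPoly_apply_eq_zero ρ κ w z hz ?_
    rw [hρτ, hκτ]
    have h1 := (ρ a).isLt; have h2 := (ρ c).isLt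
    omega
  have hG₀T : ((hess0 (transl (fun u : Fin n × Fin n => if u.1 = (ρ⁻¹ * κ) u.2 then (1 : ℂ) else 0)
      (perPoly (Fin n) ℂ))).submatrix id ι).BlockTriangular β := by
    rintro ⟨c, d⟩ ⟨a, b⟩ hlt
    rw [hβ, hβ] at hlt
    rw [Matrix.submatrix_apply, id, hι]
    refine hess0_transl_unitri_perPoly_apply_eq_zero ρ κ (fun _ => 0) _ hz0 ?_
    rw [hρτ, hκτ]
    have h1 := (ρ a).isLt; have h2 := (ρ c).isLt
    omega
  -- equal diagonal blocks
  have hblocks : ∀ k, ((hess0 (transl z (perPoly (Fin n) ℂ))).submatrix id ι).toSquareBlock β k =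
      ((hess0 (transl (fun u : Fin n × Fin n => if u.1 = (ρ⁻¹ * κ) u.2 then (1 : ℂ) else 0)
        (perPoly (Fin n) ℂ))).submatrix id ι).toSquareBlock β k := by
    intro k
    ext ⟨⟨c, d⟩, hcd⟩ ⟨⟨a, b⟩, hab⟩
    change β (c, d) = k at hcd
    change β (a, b) = k at hab
    rw [Matrix.toSquareBlock_def, Matrix.toSquareBlock_def]
    change (hess0 (transl z (perPoly (Fin n) ℂ))).submatrix id ι (c, d) (a, b) =
      (hess0 (transl (fun u : Fin n × Fin n => if u.1 = (ρ⁻¹ * κ) u.2 then (1 : ℂ) else 0)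
        (perPoly (Fin n) ℂ))).submatrix id ι (c, d) (a, b)
    rw [Matrix.submatrix_apply, Matrix.submatrix_apply, id, hι]
    refine hess0_transl_unitri_perPoly_apply_eq_perm ρ κ w z hz ?_
    rw [hρτ, hκτ]
    rw [hβ] at hcd hab
    have h1 := (ρ a).isLt; have h2 := (ρ c).isLt
    omega
  have hdetG : ((hess0 (transl z (perPoly (Fin n) ℂ))).submatrix id ι).det =
      ((hess0 (transl (fun u : Fin n × Fin n => if u.1 = (ρ⁻¹ * κ) u.2 then (1 : ℂ) else 0)
        (perPoly (Fin n) ℂ))).submatrix id ι).det := by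
    rw [hGT.det, hG₀T.det]
    exact Finset.prod_congr rfl fun k _ => by rw [hblocks k]
  -- `det H₀ ≠ 0` (✓ p836772), hence `det G₀ ≠ 0`, `det G ≠ 0`, `det H ≠ 0`
  have hH₀u : IsUnit (hess0 (transl (fun u : Fin n × Fin n => if u.1 = (ρ⁻¹ * κ) u.2 then (1 : ℂ) else 0)
      (perPoly (Fin n) ℂ))) :=
    Matrix.mulVec_injective_iff_isUnit.mp (hess0_transl_permPoint_perPoly_mulVec_injective (by omega) (ρ⁻¹ * κ))
  have hH₀det := ((Matrix.isUnit_iff_isUnit_det _).mp hH₀u).ne_zero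
  have hG₀det : ((hess0 (transl (fun u : Fin n × Fin n => if u.1 = (ρ⁻¹ * κ) u.2 then (1 : ℂ) else 0)
      (perPoly (Fin n) ℂ))).submatrix id ι).det ≠ 0 := by
    rw [Matrix.det_permute']
    refine mul_ne_zero ?_ hH₀det
    rcases Int.units_eq_one_or (Equiv.Perm.sign ι) with h | h <;> simp [h]
  have hHdet : (hess0 (transl z (perPoly (Fin n) ℂ))).det ≠ 0 := by
    intro h0
    apply hG₀det
    rw [← hdetG, Matrix.det_permute', h0, mul_zero]
  have hHu : IsUnit (hess0 (transl z (perPoly (Fin n) ℂ))) :=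
    (Matrix.isUnit_iff_isUnit_det _).mpr (isUnit_iff_ne_zero.mpr hHdet)
  rw [Matrix.rank_of_isUnit _ hHu, Fintype.card_prod, Fintype.card_fin, sq]

end UnitriangularPoint

end Summit.ValiantsHypothesis.ValiantsHypothesis.Theorems.GrenetZeonTwoDimCoefficients.ScalingClosure

end
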